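import Summits.NavierStokesRegularity.NavierStokesRegularity.Theorems.HubbleDynamoNoSelfExcitedDynamoEquivalence
import Literature.Analysis.FluidPDE.AncientMildCompactness
import Literature.Analysis.FluidPDE.ClassicalSolutionGlue
import Literature.Analysis.FluidPDE.PineauVicolRSSChaeWolf
import Literature.Analysis.FluidPDE.TypeIAncientMildClassical
import HarnessLib

/-!
# Crux `NoSelfExcitedDynamo` (stmt-NavierStokesRegularity-1934), line `registered`: the α-limit of
  an eternal profile-class solution realises a past amplitude floor at every similarity time

Theorems file (lands `--supports stmt-NavierStokesRegularity-1934`; registered sub-goal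
`stub_alphaLimit`). Let `(U, P)` be an ETERNAL classical solution of Leray's backward system
`∂ₛU + ½U + ½(y·∇)U + (U·∇)U + ∇P = ΔU`, `div U = 0` on `ℝ × ℝ³` in the uniform profile class
`(1 + ‖y‖)^{k+1}‖DᵏU(s, y)‖ ≤ K_k`, and suppose that `U` keeps an amplitude floor `δ` on a past
half-line: `∀ s ≤ S, ∃ y, δ ≤ ‖U(s, y)‖`. Then some eternal profile-class solution `(W, Q)` keeps the
floor `δ` at EVERY similarity time (`stub_alphaLimit`). For `δ ≤ 0` take `W = U`; for `δ > 0`,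
`W` is an α-limit of `U` (KNSS 2009, Lemma 6.1):

1. the `s`-translates `U(· + σ)`, `σ = S − n`, are eternal solutions with the same profile constants
   (`IsClassicalNSSolutionOn.comp_add_right`: Leray's drift force translates with `U`), so their
   physical fields `u_n = ofLerayOrbit (U(· + σ_n))` are classical on `(−∞, 0)`
   (`isClassicalNSSolutionOn_Iio_ofLerayOrbit_iff`), have the pointwise Type-I bound with the
   `k = 0` constant `K₀` (`hasTypeIDecay_iff_lerayOrbit`), hence are continuous, weakly
   divergence-free, Oseen-mild between all pairs of negative times (KNSS 2009, Thm 6.1, mildness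
   clause `KNSS2009_mild_of_rMulNorm_bounded_holds`, with the window bound `K₀/√(−t)`), with the
   rate `√(−τ)‖u_n(τ, x)‖ ≤ K₀` (`alphaLimit_oseen_of_classical`);
2. KNSS 2009, Lemma 6.1 in the tree's symmetry-free rate form `KNSS2009_lemma61_typeI_rate`
   extracts a subsequence converging pointwise, and locally uniformly on every negative slice, to
   an Oseen-mild field `w` with the same rate; the pointwise Type-I bound passes to the limit;
3. `w` is classical on `(−∞, 0)` with ONE pressure (`alphaLimit_classical_of_rate`): its time
   shifts `w(· − c)`, `c > 0`, are bounded continuous Oseen-mild fields on `(−∞, 0)`, hence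
   classical (`stub_classicalOfOseen`), so `w` is jointly smooth with divergence-free slices on the
   open past, i.e. a Type-I ancient mild field (`IsTypeIAncientMild`), classical on every window
   `(t₀, 0)` (`IsTypeIAncientMild.exists_isClassicalNSSolutionOn_Ioo`, Fabes–Jones–Rivière), and
   the window pressures patch (`IsClassicalNSSolutionOn.exists_pressure_Iio_of_Ioo`);
4. `(W, Q) = (lerayOrbit w, lerayOrbitPressure q)` is eternal (dictionary) and in the profile class
   (`stub_derivativeDecay`, `reduction_profileBound`) (`alphaLimit_profile`);
5. the floor passes to the limit (`alphaLimit_floor`): at the slice `t = −e^{−s}` the floor points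
   of the translates stay in a fixed ball (`1 + ‖y_n‖ ≤ K₀/δ`), on which the convergence is
   uniform, so `sup_B √(−t)‖w(t, ·)‖ ≥ δ` by continuity and compactness.

## References

* G. Koch, N. Nadirashvili, G. Seregin, V. Šverák, *Liouville theorems for the Navier–Stokes
  equations and applications*, Acta Math. 203 (2009) 83–105 = arXiv:0709.3599, Lemma 6.1 and
  Thm 6.1. [KochNadirashviliSereginSverak2009]
-/

noncomputable section

-- the mandated stub namespace repeats `NavierStokesRegularity` (tree precedent for this crux's stubs)
set_option linter.dupNamespace false

namespace Summit.NavierStokesRegularity.NavierStokesRegularity.Theorems.NoSelfExcitedDynamo.Registered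

open Set MeasureTheory Filter Topology Function Metric
open scoped ContDiff
open Literature.Analysis
open Literature.Analysis.FluidPDE

/-! ### Physical variables: Oseen-mildness and the Type-I rate of a classical Type-I field -/

/-- **A classical Type-I field on the open past is a rate-bounded Oseen-mild field.** If `(u, p)`
is a classical unforced Navier–Stokes solution (`ν = 1`) on `(−∞, 0) × ℝ³` with the pointwise
Type-I bound `‖u(t, x)‖ ≤ C/(‖x‖ + √(−t))`, then `u` is continuous on the open slab, has weakly
divergence-free slices, satisfies the Oseen integral identity
`u(t) = e^{(t−s)Δ}u(s) − B¹ₛ(u, u)(t)` for all `s < t < 0` (KNSS 2009, Thm 6.1, mildness clause,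
on the windows `(s − 1, 0)` with the bound `‖u‖ ≤ C/√(−t)` on `(s − 1, t]` and `r‖u‖ ≤ C`), and
has the rate `√(−t)‖u(t, x)‖ ≤ C`. -/
theorem alphaLimit_oseen_of_classical
    {u : ℝ → EuclideanSpace ℝ (Fin 3) → EuclideanSpace ℝ (Fin 3)}
    {p : ℝ → EuclideanSpace ℝ (Fin 3) → ℝ} (hcl : IsClassicalNSSolutionOn (Iio 0) 1 0 u p)
    {C : ℝ} (hdec : HasTypeIDecay C u) :
    ContinuousOn (uncurry u) (Iio 0 ×ˢ univ) ∧
    (∀ t < 0, IsWeaklyDivFree (u t)) ∧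
    (∀ s t : ℝ, s < t → t < 0 → ∀ x,
      u t x = UnboundedOperators.heatExtension (u s) (t - s) x - oseenDuhamel 1 s u u t x) ∧
    (∀ t < 0, ∀ x, Real.sqrt (-t) * ‖u t x‖ ≤ C) := by
  have hC : 0 ≤ C := by
    have h := hdec (-1) (by norm_num) 0
    rw [norm_zero, zero_add, neg_neg, Real.sqrt_one, div_one] at h
    exact (norm_nonneg _).trans h
  -- the window bound `‖u τ x‖ ≤ C / √(-t)` for `τ ≤ t < 0`
  have hbd : ∀ {τ t : ℝ}, τ ≤ t → t < 0 → ∀ x, ‖u τ x‖ ≤ C / Real.sqrt (-t) := by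
    intro τ t hτt ht x
    have hτ : τ < 0 := lt_of_le_of_lt hτt ht
    have hst : 0 < Real.sqrt (-t) := Real.sqrt_pos.2 (neg_pos.2 ht)
    calc ‖u τ x‖ ≤ C / (‖x‖ + Real.sqrt (-τ)) := hdec τ hτ x
      _ ≤ C / Real.sqrt (-t) := by
        refine div_le_div_of_nonneg_left hC hst ?_
        calc Real.sqrt (-t) ≤ Real.sqrt (-τ) := Real.sqrt_le_sqrt (by linarith)
          _ ≤ ‖x‖ + Real.sqrt (-τ) := le_add_of_nonneg_left (norm_nonneg _)
  refine ⟨hcl.smooth_velocity.continuousOn, fun t ht => ?_, fun s t hst ht x => ?_,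
    fun t ht x => ?_⟩
  · exact VectorCalculus.IsDivFree.isWeaklyDivFree_holds (hcl.divFree t ht)
      ((hcl.contDiff_velocity ht).of_le (by norm_cast))
  · have hwin : IsClassicalNSSolutionOn (Ioo (s - 1) 0) 1 0 u p :=
      hcl.mono (fun τ hτ => hτ.2) (uniqueDiffOn_Ioo _ _)
    have hL' : ∃ L : ℝ, ∀ τ ∈ Ioc (s - 1) t, ∀ x, ‖u τ x‖ ≤ L :=
      ⟨C / Real.sqrt (-t), fun τ hτ x => hbd hτ.2 ht x⟩
    exact KNSS2009_mild_of_rMulNorm_bounded_holds hwin (by linarith) ht hL'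
      ⟨C, fun τ hτ x => reduction_cylRadius_mul_norm_le hdec τ (hτ.2.trans_lt ht) x⟩
      (by linarith) hst le_rfl x
  · have hst : 0 < Real.sqrt (-t) := Real.sqrt_pos.2 (neg_pos.2 ht)
    have hden : 0 < ‖x‖ + Real.sqrt (-t) := by positivity
    calc Real.sqrt (-t) * ‖u t x‖ ≤ Real.sqrt (-t) * (C / (‖x‖ + Real.sqrt (-t))) :=
          mul_le_mul_of_nonneg_left (hdec t ht x) hst.le
      _ = C * (Real.sqrt (-t) / (‖x‖ + Real.sqrt (-t))) := by ring
      _ ≤ C * 1 := mul_le_mul_of_nonneg_left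
          ((div_le_one hden).2 (le_add_of_nonneg_left (norm_nonneg _))) hC
      _ = C := mul_one C

/-- **The physical field of an eternal profile-class solution.** If `(V, Q)` solves Leray's
backward system on `ℝ × ℝ³` with `(1 + ‖y‖)‖V(s, y)‖ ≤ K₀`, then `ofLerayOrbit V` is a classical
unforced Navier–Stokes solution on `(−∞, 0)` (pressure `ofLerayOrbitPressure Q`; dictionary
`isClassicalNSSolutionOn_Iio_ofLerayOrbit_iff`) with the pointwise Type-I bound with constant `K₀`
(`hasTypeIDecay_iff_lerayOrbit`, `lerayOrbit ∘ ofLerayOrbit = id`). -/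
theorem alphaLimit_physical {V : ℝ → EuclideanSpace ℝ (Fin 3) → EuclideanSpace ℝ (Fin 3)}
    {Q : ℝ → EuclideanSpace ℝ (Fin 3) → ℝ} (hV : IsBackwardLeraySolutionOn univ 1 V Q) {K₀ : ℝ}
    (hK₀ : ∀ s y, (1 + ‖y‖) * ‖V s y‖ ≤ K₀) :
    IsClassicalNSSolutionOn (Iio 0) 1 0 (ofLerayOrbit V) (ofLerayOrbitPressure Q) ∧
    HasTypeIDecay K₀ (ofLerayOrbit V) := by
  refine ⟨isClassicalNSSolutionOn_Iio_ofLerayOrbit_iff.2 hV,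
    hasTypeIDecay_iff_lerayOrbit.2 fun s y => ?_⟩
  rw [lerayOrbit_ofLerayOrbit_eq]
  exact hK₀ s y

/-- **Translates in similarity time are eternal solutions.** Leray's backward system is autonomous
in `s`: if `(U, P)` solves it on `ℝ × ℝ³`, so does `(U(· + σ), P(· + σ))` for every `σ`
(`IsClassicalNSSolutionOn.comp_add_right`; the drift force `−½(U + (y·∇)U)` translates with `U`). -/
theorem alphaLimit_translate {U : ℝ → EuclideanSpace ℝ (Fin 3) → EuclideanSpace ℝ (Fin 3)}
    {P : ℝ → EuclideanSpace ℝ (Fin 3) → ℝ} (hL : IsBackwardLeraySolutionOn univ 1 U P) (σ : ℝ) :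
    IsBackwardLeraySolutionOn univ 1 (fun s => U (s + σ)) (fun s => P (s + σ)) := by
  have h := hL.comp_add_right σ
  rwa [Set.preimage_univ] at h

/-! ### The limit field is classical on the open past with one pressure -/

/-- **A rate-bounded Oseen-mild ancient field is classical on `(−∞, 0)` with one pressure.** Let
`w` be continuous on `(−∞, 0) × ℝ³`, with weakly divergence-free slices, Oseen-mild between all
pairs of negative times, with the Type-I rate `√(−t)‖w(t, x)‖ ≤ C`. Its time shifts `w(· − c)`,
`c > 0`, are bounded by `C/√c` on `(−∞, 0)`, continuous, weakly divergence-free and Oseen-mild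
(the Duhamel term is autonomous, `oseenDuhamel_comp_sub_right`), hence classical there
(`stub_classicalOfOseen`); so `w` is jointly smooth with divergence-free slices on the open past
(smoothness is local), i.e. a Type-I ancient mild field with constant `C`, classical on every
window `(−(k+1), 0)` (`IsTypeIAncientMild.exists_isClassicalNSSolutionOn_Ioo`), and the window
pressures patch to one pressure (`IsClassicalNSSolutionOn.exists_pressure_Iio_of_Ioo`). -/
theorem alphaLimit_classical_of_rate
    {w : ℝ → EuclideanSpace ℝ (Fin 3) → EuclideanSpace ℝ (Fin 3)}
    (hcont : ContinuousOn (uncurry w) (Iio 0 ×ˢ univ))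
    (hdiv : ∀ t < 0, IsWeaklyDivFree (w t))
    (hmild : ∀ s t : ℝ, s < t → t < 0 → ∀ x,
      w t x = UnboundedOperators.heatExtension (w s) (t - s) x - oseenDuhamel 1 s w w t x)
    {C : ℝ} (hrate : ∀ t < 0, ∀ x, Real.sqrt (-t) * ‖w t x‖ ≤ C) :
    ∃ q : ℝ → EuclideanSpace ℝ (Fin 3) → ℝ, IsClassicalNSSolutionOn (Iio 0) 1 0 w q := by
  have hC : 0 ≤ C :=
    (mul_nonneg (Real.sqrt_nonneg _) (norm_nonneg _)).trans (hrate (-1) (by norm_num) 0)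
  have hnorm : ∀ t < 0, ∀ x, ‖w t x‖ ≤ C / Real.sqrt (-t) := fun t ht x => by
    have hs : 0 < Real.sqrt (-t) := Real.sqrt_pos.2 (neg_pos.2 ht)
    rw [le_div_iff₀ hs, mul_comm]
    exact hrate t ht x
  -- the time shifts `w(· - c)`, `c > 0`, are classical on `Iio 0`
  have hshift : ∀ c : ℝ, 0 < c → ∃ q : ℝ → EuclideanSpace ℝ (Fin 3) → ℝ,
      IsClassicalNSSolutionOn (Iio 0) 1 0 (fun t => w (t - c)) q := by
    intro c hc
    refine stub_classicalOfOseen (fun t => w (t - c)) ?_ ⟨C / Real.sqrt c, fun t ht x => ?_⟩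
      (fun t ht => hdiv (t - c) (by linarith)) fun s t hst ht x => ?_
    · have e : (Function.uncurry fun t x => w (t - c) x) =
          uncurry w ∘ fun z : ℝ × EuclideanSpace ℝ (Fin 3) => (z.1 - c, z.2) := rfl
      rw [e]
      refine hcont.comp (by fun_prop) fun z hz => ⟨?_, mem_univ _⟩
      have hz1 : z.1 < 0 := hz.1
      show z.1 - c < 0
      linarith
    · have htc : t - c < 0 := by linarith
      refine (hnorm (t - c) htc x).trans ?_
      exact div_le_div_of_nonneg_left hC (Real.sqrt_pos.2 hc) (Real.sqrt_le_sqrt (by linarith))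
    · have key := hmild (s - c) (t - c) (by linarith) (by linarith) x
      show w (t - c) x = UnboundedOperators.heatExtension (w (s - c)) (t - s) x -
        oseenDuhamel 1 s (fun τ => w (τ - c)) (fun τ => w (τ - c)) t x
      rw [oseenDuhamel_comp_sub_right]
      rwa [sub_sub_sub_cancel_right] at key
  -- `w` is a Type-I ancient mild field in the Oseen gauge
  have hw : IsTypeIAncientMild C w := by
    refine ⟨?_, fun t ht => ?_, fun s t hst ht x => ?_, fun t ht x => hnorm t ht x⟩
    · refine contDiffOn_of_locally_contDiffOn fun z hz => ?_
      obtain ⟨t, x⟩ := z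
      have ht : t < 0 := hz.1
      obtain ⟨q, hq⟩ := hshift (-t / 2) (by linarith)
      refine ⟨Iio (-(-t / 2)) ×ˢ univ, isOpen_Iio.prod isOpen_univ,
        ⟨show t < -(-t / 2) by linarith, mem_univ _⟩, ?_⟩
      have hsm : IsSmoothSpaceTimeOn ((fun τ : ℝ => τ + -t / 2) ⁻¹' Iio 0)
          (fun τ => w (τ + -t / 2 - -t / 2)) := hq.smooth_velocity.comp_add_right (-t / 2)
      have hset : (fun τ : ℝ => τ + -t / 2) ⁻¹' Iio 0 = Iio (-(-t / 2)) := by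
        ext τ
        simp only [mem_preimage, mem_Iio]
        constructor <;> intro h <;> linarith
      have hfun : (fun τ : ℝ => w (τ + -t / 2 - -t / 2)) = w := by
        funext τ
        rw [add_sub_cancel_right]
      rw [hset, hfun] at hsm
      exact ContDiffOn.mono hsm inter_subset_right
    · obtain ⟨q, hq⟩ := hshift (-t / 2) (by linarith)
      have key : VectorCalculus.IsDivFree (w (t / 2 - -t / 2)) :=
        hq.divFree (t / 2) (show t / 2 < 0 by linarith)
      rwa [show t / 2 - -t / 2 = t by ring] at key
    · rw [heatFlow_of_pos _ (sub_pos.2 hst)]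
      exact hmild s t hst ht x
  -- windows and one pressure
  have hwin : ∀ k : ℕ, ∃ q : ℝ → EuclideanSpace ℝ (Fin 3) → ℝ,
      IsClassicalNSSolutionOn (Ioo (-((k : ℝ) + 1)) 0) 1 0 w q := fun k =>
    hw.exists_isClassicalNSSolutionOn_Ioo (by have hk := k.cast_nonneg (α := ℝ); linarith)
  choose q hq using hwin
  refine IsClassicalNSSolutionOn.exists_pressure_Iio_of_Ioo (a := fun k : ℕ => -((k : ℝ) + 1)) hq
    fun t ht => ?_
  obtain ⟨k, hk⟩ := exists_nat_gt (-t)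
  exact ⟨k, by linarith⟩

/-- **The similarity transform of a classical Type-I field is an eternal profile-class solution.**
If `(w, q)` is classical on `(−∞, 0)` with the pointwise Type-I bound with constant `C`, then
`(lerayOrbit w, lerayOrbitPressure q)` solves Leray's backward system on `ℝ × ℝ³`
(`isClassicalNSSolutionOn_Iio_iff_isBackwardLeraySolutionOn`) and lies in the uniform profile class
(all derivatives are Type-I, `stub_derivativeDecay`; scale-invariant bounds are profile bounds,
`reduction_profileBound`). -/
theorem alphaLimit_profile {w : ℝ → EuclideanSpace ℝ (Fin 3) → EuclideanSpace ℝ (Fin 3)}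
    {q : ℝ → EuclideanSpace ℝ (Fin 3) → ℝ} (hcl : IsClassicalNSSolutionOn (Iio 0) 1 0 w q) {C : ℝ}
    (hdec : HasTypeIDecay C w) :
    IsBackwardLeraySolutionOn univ 1 (lerayOrbit w) (lerayOrbitPressure q) ∧
    ∀ k : ℕ, ∃ K : ℝ, ∀ s y,
      (1 + ‖y‖) ^ (k + 1) * ‖iteratedFDeriv ℝ k (lerayOrbit w s) y‖ ≤ K := by
  refine ⟨isClassicalNSSolutionOn_Iio_iff_isBackwardLeraySolutionOn.1 hcl, fun k => ?_⟩
  obtain ⟨C', hC'⟩ := stub_derivativeDecay w q C hcl hdec k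
  exact ⟨C', reduction_profileBound w k
    (fun t ht => (hcl.contDiff_velocity ht).of_le (by exact_mod_cast le_top)) hC'⟩

/-! ### The floor passes to locally uniform limits -/

/-- **Floors in a fixed ball pass to locally uniform limits.** If `F_j → f` locally uniformly on
`ℝ³`, `f` is continuous, `c > 0`, and eventually every `F_j` has a point `x_j` in the fixed ball
`B̄(0, R)` with `δ ≤ c‖F_j(x_j)‖`, then `δ ≤ c‖f(x)‖` for some `x`: otherwise the continuous gap
`δ − c‖f‖` has a positive minimum `ε` on the compact ball, and uniform convergence on the ball
makes `c‖F_j‖ < c‖f‖ + ε ≤ δ` there for large `j`. -/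
theorem alphaLimit_floor {F : ℕ → EuclideanSpace ℝ (Fin 3) → EuclideanSpace ℝ (Fin 3)}
    {f : EuclideanSpace ℝ (Fin 3) → EuclideanSpace ℝ (Fin 3)}
    (hF : TendstoLocallyUniformly F f atTop) (hf : Continuous f) {c δ R : ℝ} (hc : 0 < c)
    (hfl : ∀ᶠ j in atTop, ∃ x ∈ closedBall (0 : EuclideanSpace ℝ (Fin 3)) R, δ ≤ c * ‖F j x‖) :
    ∃ x, δ ≤ c * ‖f x‖ := by
  by_contra hcon
  push Not at hcon
  have hBc : IsCompact (closedBall (0 : EuclideanSpace ℝ (Fin 3)) R) := isCompact_closedBall 0 R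
  obtain ⟨j₀, x₀', hx₀', -⟩ := hfl.exists
  have hBne : (closedBall (0 : EuclideanSpace ℝ (Fin 3)) R).Nonempty := ⟨x₀', hx₀'⟩
  -- the gap `δ - c‖f‖` has a positive minimum on the ball
  have hgc : ContinuousOn (fun x => δ - c * ‖f x‖) (closedBall (0 : EuclideanSpace ℝ (Fin 3)) R) :=
    (continuous_const.sub (continuous_const.mul hf.norm)).continuousOn
  obtain ⟨x₀, -, hmin⟩ := hBc.exists_isMinOn hBne hgc
  have hε : 0 < δ - c * ‖f x₀‖ := by linarith [hcon x₀]
  -- uniform convergence on the ball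
  have hunif : TendstoUniformlyOn F f atTop (closedBall (0 : EuclideanSpace ℝ (Fin 3)) R) :=
    (tendstoLocallyUniformly_iff_forall_isCompact.1 hF) _ hBc
  have hev := (Metric.tendstoUniformlyOn_iff.1 hunif) ((δ - c * ‖f x₀‖) / c) (div_pos hε hc)
  obtain ⟨j, ⟨x, hxB, hxδ⟩, hj⟩ := (hfl.and hev).exists
  have hdist : dist (f x) (F j x) < (δ - c * ‖f x₀‖) / c := hj x hxB
  have hminx : δ - c * ‖f x₀‖ ≤ δ - c * ‖f x‖ := (isMinOn_iff.1 hmin) x hxB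
  have htri : ‖F j x‖ ≤ ‖f x‖ + dist (f x) (F j x) := by
    rw [dist_eq_norm]
    exact norm_le_norm_add_norm_sub _ _
  have hlt : c * ‖F j x‖ < δ :=
    calc c * ‖F j x‖ ≤ c * (‖f x‖ + dist (f x) (F j x)) := mul_le_mul_of_nonneg_left htri hc.le
      _ < c * (‖f x‖ + (δ - c * ‖f x₀‖) / c) := by gcongr
      _ = c * ‖f x‖ + (δ - c * ‖f x₀‖) := by field_simp
      _ ≤ δ := by linarith
  linarith

/-! ### The registered stub -/

/-- **Stub `stub_alphaLimit`** (KNSS 2009, Lemma 6.1, α-limit form). If an eternal profile-class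
solution `(U, P)` of Leray's backward system keeps an amplitude floor `δ` on a past half-line
(`∀ s ≤ S, ∃ y, δ ≤ ‖U(s, y)‖`), then some eternal profile-class solution `(W, Q)` keeps the floor
`δ` at EVERY similarity time. For `δ ≤ 0` take `W = U`. For `δ > 0`: the physical fields
`u_n = ofLerayOrbit (U(· + (S − n)))` of the translates are classical Type-I fields on `(−∞, 0)`
with the `k = 0` constant `K₀`, hence rate-bounded Oseen-mild fields
(`alphaLimit_oseen_of_classical`); `KNSS2009_lemma61_typeI_rate` extracts a locally uniform limit
`w`, which inherits the pointwise Type-I bound, is classical with one pressure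
(`alphaLimit_classical_of_rate`), so that `(W, Q) = (lerayOrbit w, lerayOrbitPressure q)` is
eternal and in the profile class (`alphaLimit_profile`); the floor at time `s` is read at the
physical slice `t = −e^{−s}`, where the floor points of the translates `U((S − n) + s, ·)`, `n ≥ s`,
stay in the ball of radius `e^{−s/2}K₀/δ`, and passes to the limit (`alphaLimit_floor`). -/
theorem stub_alphaLimit :
    ∀ (U : ℝ → EuclideanSpace ℝ (Fin 3) → EuclideanSpace ℝ (Fin 3)) (P : ℝ → EuclideanSpace ℝ (Fin 3) → ℝ),
      IsBackwardLeraySolutionOn univ 1 U P →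
      (∀ k : ℕ, ∃ K : ℝ, ∀ s y, (1 + ‖y‖) ^ (k + 1) * ‖iteratedFDeriv ℝ k (U s) y‖ ≤ K) →
      ∀ (δ S : ℝ), (∀ s ≤ S, ∃ y, δ ≤ ‖U s y‖) →
        ∃ (W : ℝ → EuclideanSpace ℝ (Fin 3) → EuclideanSpace ℝ (Fin 3)) (Q : ℝ → EuclideanSpace ℝ (Fin 3) → ℝ),
          IsBackwardLeraySolutionOn univ 1 W Q ∧
          (∀ k : ℕ, ∃ K : ℝ, ∀ s y, (1 + ‖y‖) ^ (k + 1) * ‖iteratedFDeriv ℝ k (W s) y‖ ≤ K) ∧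
          ∀ s, ∃ y, δ ≤ ‖W s y‖ := by
  intro U P hL hprof δ S hfl
  rcases le_or_gt δ 0 with hδ | hδ
  · exact ⟨U, P, hL, hprof, fun s => ⟨0, hδ.trans (norm_nonneg _)⟩⟩
  -- the `k = 0` profile constant
  obtain ⟨K₀, hK₀'⟩ := hprof 0
  have hK₀ : ∀ s y, (1 + ‖y‖) * ‖U s y‖ ≤ K₀ := fun s y => by
    have h := hK₀' s y
    rwa [zero_add, pow_one, norm_iteratedFDeriv_zero] at h
  -- the physical fields of the translates `U(· + (S - n))`
  obtain ⟨u, hu⟩ : ∃ u : ℕ → ℝ → EuclideanSpace ℝ (Fin 3) → EuclideanSpace ℝ (Fin 3),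
      ∀ n, u n = ofLerayOrbit fun s => U (s + (S - (n : ℝ))) := ⟨_, fun n => rfl⟩
  have hphys : ∀ n : ℕ,
      IsClassicalNSSolutionOn (Iio 0) 1 0 (u n) (ofLerayOrbitPressure fun s => P (s + (S - (n : ℝ)))) ∧
      HasTypeIDecay K₀ (u n) := fun n => by
    rw [hu n]
    exact alphaLimit_physical (alphaLimit_translate hL _) fun s y => hK₀ _ y
  have hdec : ∀ n, HasTypeIDecay K₀ (u n) := fun n => (hphys n).2
  have hos : ∀ n : ℕ, ContinuousOn (uncurry (u n)) (Iio 0 ×ˢ univ) ∧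
      (∀ t < 0, IsWeaklyDivFree (u n t)) ∧
      (∀ s t : ℝ, s < t → t < 0 → ∀ x, u n t x =
        UnboundedOperators.heatExtension (u n s) (t - s) x - oseenDuhamel 1 s (u n) (u n) t x) ∧
      (∀ t < 0, ∀ x, Real.sqrt (-t) * ‖u n t x‖ ≤ K₀) := fun n =>
    alphaLimit_oseen_of_classical (hphys n).1 (hdec n)
  -- the dictionary: `U((S - n) + s, y) = e^{-s/2} u_n(-e^{-s}, e^{-s/2} y)`
  have hdict : ∀ (n : ℕ) (s : ℝ) (y : EuclideanSpace ℝ (Fin 3)), U (s + (S - (n : ℝ))) y =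
      Real.exp (-s / 2) • u n (-Real.exp (-s)) (Real.exp (-s / 2) • y) := by
    intro n s y
    have h := congrFun (congrFun (lerayOrbit_ofLerayOrbit_eq fun s' => U (s' + (S - (n : ℝ)))) s) y
    rw [lerayOrbit_apply, ← hu n] at h
    exact h.symm
  -- KNSS 2009, Lemma 6.1 (Type-I-rate form): a locally uniform limit of a subsequence
  have hA : Tendsto (fun k : ℕ => -((k : ℝ) + 1)) atTop atBot :=
    tendsto_neg_atTop_atBot.comp (tendsto_atTop_add_const_right _ _ tendsto_natCast_atTop_atTop)
  obtain ⟨φ, w, hφ, hwc, hwdiv, hwrate, hwmild, -, hpt, hloc⟩ :=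
    KNSS2009_lemma61_typeI_rate (A := fun k : ℕ => -((k : ℝ) + 1)) (w := u) (C := K₀) hA
      (fun n => (hos n).1.mono (prod_mono (fun τ hτ => hτ.2) Subset.rfl))
      (fun n t ht => (hos n).2.1 t ht.2)
      (fun n s t _ hst ht x => (hos n).2.2.1 s t hst ht x)
      (fun n τ hτ x => (hos n).2.2.2 τ hτ.2 x)
  -- the pointwise Type-I bound passes to the limit
  have hdecw : HasTypeIDecay K₀ w := fun t ht x =>
    le_of_tendsto (hpt t ht x).norm (Eventually.of_forall fun j => hdec (φ j) t ht x)
  -- the limit is classical with one pressure, its profile is eternal and in the profile class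
  obtain ⟨q, hclw⟩ := alphaLimit_classical_of_rate hwc hwdiv hwmild hwrate
  obtain ⟨hW, hWprof⟩ := alphaLimit_profile hclw hdecw
  refine ⟨lerayOrbit w, lerayOrbitPressure q, hW, hWprof, fun s => ?_⟩
  -- the floor at similarity time `s`, read at the physical slice `t = -e^{-s}`
  have ht : -Real.exp (-s) < 0 := neg_exp_neg_lt_zero s
  have hc : 0 < Real.exp (-s / 2) := Real.exp_pos _
  have hfl' : ∀ᶠ j in atTop, ∃ x ∈ closedBall (0 : EuclideanSpace ℝ (Fin 3)) (Real.exp (-s / 2) * (K₀ / δ)),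
      δ ≤ Real.exp (-s / 2) * ‖u (φ j) (-Real.exp (-s)) x‖ := by
    have hev : ∀ᶠ n : ℕ in atTop, s ≤ (n : ℝ) :=
      tendsto_natCast_atTop_atTop.eventually (eventually_ge_atTop s)
    filter_upwards [hφ.tendsto_atTop.eventually hev] with j hj
    obtain ⟨y, hy⟩ := hfl (s + (S - (φ j : ℝ))) (by linarith)
    have hy1 : (1 + ‖y‖) * δ ≤ K₀ :=
      (mul_le_mul_of_nonneg_left hy (by positivity)).trans (hK₀ _ y)
    have hyR : ‖y‖ ≤ K₀ / δ := by
      rw [le_div_iff₀ hδ]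
      nlinarith [norm_nonneg y]
    refine ⟨Real.exp (-s / 2) • y, ?_, ?_⟩
    · rw [mem_closedBall, dist_zero_right, norm_smul, Real.norm_of_nonneg hc.le]
      exact mul_le_mul_of_nonneg_left hyR hc.le
    · rw [hdict (φ j) s y, norm_smul, Real.norm_of_nonneg hc.le] at hy
      exact hy
  obtain ⟨x, hx⟩ :=
    alphaLimit_floor (hloc _ ht) (hclw.contDiff_velocity ht).continuous hc hfl'
  refine ⟨(Real.exp (-s / 2))⁻¹ • x, ?_⟩
  rw [lerayOrbit_apply, smul_smul, mul_inv_cancel₀ hc.ne', one_smul, norm_smul,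
    Real.norm_of_nonneg hc.le]
  exact hx

end Summit.NavierStokesRegularity.NavierStokesRegularity.Theorems.NoSelfExcitedDynamo.Registered

end
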